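import Summits.NavierStokesRegularity.FluidComputer.ClayBlowupTaoPressure
import Summits.NavierStokesRegularity.FluidComputer.ClayBlowupFarField
import Literature.Analysis.FluidPDE.NSForcedLerayRateHolds
import HarnessLib

/-!
# LERAY'S RATE WITH LERAY'S EXPONENT FOR EVERY CLAY BLOW-UP — WITH THE CLAY FORCE:
# `liminf_{t → T⁻} (T − t)^{(1 − 3/q)/2} ‖u(t)‖_{L^q} ≥ C(ν, q) > 0` for every `3 < q < ∞`

Cell `ns-blowup`, seat `ns-blowup-ecbridge-2` (g8; the E–C endpoint theory seat). LABEL: E–C typing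
(KERNEL — no named fact). WHAT THIS IS NOT: not Navier–Stokes evidence — a necessary condition on the
TYPES `ClayBlowup ν` / `DesignedBlowup ν` (the (C)-certificate type WITH its Clay force; no inhabitant
is claimed anywhere). Companion memo: `run/shared/lean/pub/ns-blowup/ecbridge2/ECBRIDGE-2-MEMO-7.md`.

## Content (row R5 PROPER of MEMO-1, FORCED — Lemarié-Rieusset 2016, Thm. 11.4)

MEMO-1 (R5) asked to TYPE Leray's criterion with force as a named fact; the literature lineage typed
it (`lemarieRieusset2016_lerayRate_forced`, LR16 Thm. 11.4 for maximal classical solutions with Clay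
data) and has since PROVED it (`lemarieRieusset2016_lerayRate_forced_holds`, lit: forced short-time
sup-norm bound, forced Serrin at `r = ∞` on re-gauged pieces, forced `H¹` continuation). The E–C rows
on the type so far were the exponent-only forms `not_subLerayRate` / `not_subTypeI` (g5: no rate with
an exponent strictly below Leray's). This file delivers the SHARP forced row:

* **`ClayBlowup.forced_leray_rate`** — for every `ν > 0` and `3 < q < ∞` there is `C = C(ν, q) > 0`
  such that EVERY Clay blow-up `X : ClayBlowup ν` has
  `C ≤ liminf_{t → T⁻} (T − t)^{(1 − 3/q)/2} ‖u(t)‖_{L^q}` (in `ℝ≥0∞`): near its lifespan the `L^q` norm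
  is at least Leray's self-similar rate, uniformly over all designs at that viscosity. The hypotheses
  of the Literature theorem are fields or theorems of the type: maximality
  (`isMaximalSmoothSolution`, g6), Tao's class on closed sub-slabs (`hasBoundedSobolevNormsOn_subslabs`)
  and for `∂ₜu` (`exists_taoPressure`, g5: the re-pressurised slab solution), slab energies, Clay
  datum and force;
* `ClayBlowup.forced_leray_rate_eventually` — for every `b < C`, eventually as `t ↑ T`:
  `b < (T − t)^{(1 − 3/q)/2} ‖u(t)‖_{L^q}`;
* the `DesignedBlowup` twins and the (C)-reading `clayBlowup_forced_leray_rate_of_breakdownR3`.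

(The `L^∞` endpoint `c √ν/√(T − t) ≤ ‖u(t)‖_∞` at EVERY `t` is in `ClayBlowupLerayRate.lean` for the
UNFORCED type; with force, interpolation against the bounded energy turns the `L^q` rows into
`‖u(t)‖_∞ ≳ (T − t)^{−γ}` for every `γ < 1/2`, which is g5's `not_subTypeI`.)

References: P. G. Lemarié-Rieusset, *The Navier–Stokes Problem in the 21st Century* (2016), Thm. 11.4
with Thm. 11.5, Thm. 7.2 [cite: LemarieRieusset2016, Thm. 11.4 (p. 327)]; J. Leray, Acta Math. 63 (1934),
§22 (3.20) [cite: Leray1934, §22 (3.20)]; C. L. Fefferman, Clay problem description, (C)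
[cite: FeffermanClay2006, (C)].
-/

noncomputable section

namespace Summit.NavierStokesRegularity.FluidComputer

open Set MeasureTheory Filter Topology Function Metric
open scoped ENNReal ContDiff NNReal
open Literature.Analysis.FluidPDE
open Summit.NavierStokesRegularity.NavierStokesRegularity

/-- **LERAY'S `L^q` RATE FOR EVERY CLAY BLOW-UP, WITH THE CLAY FORCE** (`ν > 0`, `3 < q < ∞`; no named
fact): there is `C = C(ν, q) > 0` such that every `X : ClayBlowup ν` satisfies
`ENNReal.ofReal C ≤ liminf_{t → T⁻} (T − t)^{(1 − 3/q)/2} ‖u(t)‖_{L^q(ℝ³)}`. Lemarié-Rieusset 2016,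
Thm. 11.4 (the tree theorem `lemarieRieusset2016_lerayRate_forced_holds`) applied to the type's
maximal classical solution in Tao's class. [cite: LemarieRieusset2016, Thm. 11.4 (p. 327)] [cite: Leray1934, §22 (3.20)] -/
theorem ClayBlowup.forced_leray_rate {ν : ℝ} (hν : 0 < ν) {q : ℝ} (hq : 3 < q) :
    ∃ C : ℝ, 0 < C ∧ ∀ X : ClayBlowup ν,
      ENNReal.ofReal C ≤
        liminf (fun t => ENNReal.ofReal ((X.T - t) ^ ((1 - 3 / q) / 2)) *
          eLpNorm (X.u t) (ENNReal.ofReal q) volume) (𝓝[<] X.T) := by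
  obtain ⟨C, hC, hrate⟩ := lemarieRieusset2016_lerayRate_forced_holds ν q hν hq
  refine ⟨C, hC, fun X => ?_⟩
  have hTao' : ∀ T' ∈ Ioo 0 X.T,
      HasBoundedSobolevNormsOn (Icc 0 T') (timeDerivWithin (Icc 0 T') X.u) := fun T' hT' =>
    (X.exists_taoPressure hν hT'.1 hT'.2).choose_spec.2.1
  have hE : ∀ T' ∈ Ioo 0 X.T, ∃ C : ℝ≥0∞, C < ⊤ ∧ ∀ t ∈ Icc 0 T', ∫⁻ x, ‖X.u t x‖ₑ ^ 2 ≤ C :=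
    fun T' hT' => X.energy T' hT'.2
  exact hrate X.T_pos (X.isMaximalSmoothSolution hν) (X.hasBoundedSobolevNormsOn_subslabs hν) hTao'
    hE X.datum_decay X.force_smooth X.force_decay

/-- **Eventual form**: with `C = C(ν, q)` as in `forced_leray_rate`, for every `b < C` and every Clay
blow-up, `ENNReal.ofReal b < (T − t)^{(1 − 3/q)/2} ‖u(t)‖_{L^q}` for all `t < T` close enough to `T` —
no E–C certificate approaches its blow-up time below Leray's rate in any `L^q`, `3 < q < ∞`.
[cite: LemarieRieusset2016, Thm. 11.4 (p. 327)] -/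
theorem ClayBlowup.forced_leray_rate_eventually {ν : ℝ} (hν : 0 < ν) {q : ℝ} (hq : 3 < q) :
    ∃ C : ℝ, 0 < C ∧ ∀ X : ClayBlowup ν, ∀ b : ℝ, b < C →
      ∀ᶠ t in 𝓝[<] X.T,
        ENNReal.ofReal b <
          ENNReal.ofReal ((X.T - t) ^ ((1 - 3 / q) / 2)) * eLpNorm (X.u t) (ENNReal.ofReal q) volume := by
  obtain ⟨C, hC, h⟩ := ClayBlowup.forced_leray_rate hν hq
  refine ⟨C, hC, fun X b hb => ?_⟩
  have hlt : ENNReal.ofReal b < liminf (fun t => ENNReal.ofReal ((X.T - t) ^ ((1 - 3 / q) / 2)) *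
      eLpNorm (X.u t) (ENNReal.ofReal q) volume) (𝓝[<] X.T) :=
    lt_of_lt_of_le ((ENNReal.ofReal_lt_ofReal_iff hC).2 hb) (h X)
  exact eventually_lt_of_lt_liminf hlt

namespace DesignedBlowup

/-- **Leray's `L^q` rate for every designed blow-up, with the Clay force** (`ν > 0`, `3 < q < ∞`;
`toClayBlowup`). [cite: LemarieRieusset2016, Thm. 11.4 (p. 327)] -/
theorem forced_leray_rate {ν : ℝ} (hν : 0 < ν) {q : ℝ} (hq : 3 < q) :
    ∃ C : ℝ, 0 < C ∧ ∀ D : DesignedBlowup ν,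
      ENNReal.ofReal C ≤
        liminf (fun t => ENNReal.ofReal ((D.T - t) ^ ((1 - 3 / q) / 2)) *
          eLpNorm (D.u t) (ENNReal.ofReal q) volume) (𝓝[<] D.T) := by
  obtain ⟨C, hC, h⟩ := ClayBlowup.forced_leray_rate hν hq
  exact ⟨C, hC, fun D => h D.toClayBlowup⟩

/-- **Eventual form for designed blow-ups.** [cite: LemarieRieusset2016, Thm. 11.4 (p. 327)] -/
theorem forced_leray_rate_eventually {ν : ℝ} (hν : 0 < ν) {q : ℝ} (hq : 3 < q) :
    ∃ C : ℝ, 0 < C ∧ ∀ D : DesignedBlowup ν, ∀ b : ℝ, b < C →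
      ∀ᶠ t in 𝓝[<] D.T,
        ENNReal.ofReal b <
          ENNReal.ofReal ((D.T - t) ^ ((1 - 3 / q) / 2)) * eLpNorm (D.u t) (ENNReal.ofReal q) volume := by
  obtain ⟨C, hC, h⟩ := ClayBlowup.forced_leray_rate_eventually hν hq
  exact ⟨C, hC, fun D b hb => h D.toClayBlowup b hb⟩

end DesignedBlowup

/-- **THE (C)-READING: every certificate of Fefferman's (C) blows up at least at Leray's rate in every
`L^q`, `3 < q < ∞`.** If `NavierStokesBreakdownR3` holds then at every `ν > 0` some Clay blow-up exists
(`forall_nonempty_clayBlowup_of_breakdownR3`, g5), and EVERY Clay blow-up at `ν` obeys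
`C(ν, q) ≤ liminf (T − t)^{(1 − 3/q)/2} ‖u(t)‖_{L^q}`. Nothing here asserts (C).
[cite: FeffermanClay2006, (C)] [cite: LemarieRieusset2016, Thm. 11.4 (p. 327)] -/
theorem clayBlowup_forced_leray_rate_of_breakdownR3
    (hC : Summit.NavierStokesRegularity.NavierStokesRegularity.NavierStokesBreakdownR3)
    {ν : ℝ} (hν : 0 < ν) {q : ℝ} (hq : 3 < q) :
    ∃ C : ℝ, 0 < C ∧ Nonempty (ClayBlowup ν) ∧ ∀ X : ClayBlowup ν,
      ENNReal.ofReal C ≤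
        liminf (fun t => ENNReal.ofReal ((X.T - t) ^ ((1 - 3 / q) / 2)) *
          eLpNorm (X.u t) (ENNReal.ofReal q) volume) (𝓝[<] X.T) := by
  obtain ⟨C, hC0, h⟩ := ClayBlowup.forced_leray_rate hν hq
  exact ⟨C, hC0, forall_nonempty_clayBlowup_of_breakdownR3 hC ν hν, h⟩

end Summit.NavierStokesRegularity.FluidComputer

end
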